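import Summits.QuantumFields.YangMills.Theorems.AtomicCalibrationRWhitneyAssembly
import Summits.QuantumFields.YangMills.Theorems.AtomicCalibrationRGevreyMollifier

/-!
# AtomicCalibrationR (stmt-QuantumFields-28169) — the registered stub E2 `stub_offDiagonalWhitney : WhitneyPkg` BY NAME
# (LINE «MirrorCalibration» / «AtomicEngine» of planner ym-idea-11; prover w4 g23, free hands; G.1 inputs by w3 g38)

`WhitneyAssembly.whitneyPkg_of_gevrey` (construction (T): telescoping pairwise cut-offs × product grid bumps, dyadic levels, Gevrey
rates, factorial mass bookkeeping — the helper library `AtomicCalibrationR*` of w4 g22/g23) applied to the Gevrey profile of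
`GevreyMollifier.exists_gevrey_periodic_partition` (w3 g38) and the Gevrey bound `WhitneyAssembly.stepψ_gevrey` for the tree's step.
HONEST LABEL: this closes the pure-analysis stub E2 of the support item 28169 only; no crux/rung/leaf/summit; the YM mass gap is NOT
proved. [folklore]
-/

set_option autoImplicit false

namespace Summit.QuantumFields.YangMills.Cruxes.AtomicCalibrationR.MirrorCalibration

/-- **E2 `stub_offDiagonalWhitney`** — the off-diagonal Whitney package (registered stub of stmt-QuantumFields-28169, by name and
signature). [folklore] -/
theorem stub_offDiagonalWhitney : WhitneyPkg :=
  WhitneyAssembly.whitneyPkg_of_gevrey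
    (by
      obtain ⟨φ, h1, h2, h3, -, h5, C₀, C₁, hC₀, hC₁, h6⟩ := GevreyMollifier.exists_gevrey_periodic_partition
      exact ⟨φ, h1, h2, h3, h5, 2, C₀, C₁, hC₀, hC₁, h6⟩)
    (by
      obtain ⟨C₀', C₁', h1, h2, h3⟩ := WhitneyAssembly.stepψ_gevrey
      exact ⟨2, C₀', C₁', h1, h2, h3⟩)

end Summit.QuantumFields.YangMills.Cruxes.AtomicCalibrationR.MirrorCalibration
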